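import Literature.MathematicalPhysics.QuantumFieldTheory.Balaban1983to89.B9PerturbationMajorantsAtLettersPhys
import Literature.MathematicalPhysics.QuantumFieldTheory.Balaban1983to89.B9RWSums347DefiniteFaces
import Literature.MathematicalPhysics.QuantumFieldTheory.Balaban1983to89.B9RowSum261DefiniteFaces
import Literature.MathematicalPhysics.QuantumFieldTheory.Balaban1983to89.B9RWSumsDefinitePins
import Literature.MathematicalPhysics.QuantumFieldTheory.Balaban1983to89.B9CoReadingCoordsTranspose

/-!
# BalabanUVNodes ∕ N06 ([B9], `Dag.B9_main`) — THE FOUR SPLIT MAJORANTS OF (3.131)∕(3.137) (`hta htb htaR htbR` of the certificate, at the print-units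
# letter `G′_phys`) DERIVED AT def-Y's MEMBERS FROM THREE PER-LETTER SCHEMAS — (3.42)₁₂₃ for G′, (3.49)₁₂₃ for P = I − R, the (3.117)+(3.36) current bound —
# via dag-n06-l g14's `B9PerturbationMajorantsAtLettersPhys.hta∕htb∕htaR∕htbR_of_letters_phys`, the member facts and the DEFINITE row-sum constant

Track A of `YM-PLAN.md` (cell `pub-ymgap`, HUMAN RULING D-0062), node **N06** = [Balaban1985BackgroundPropagators] Thms 3.1–3.15; seat `pub-ymgap-dag-n06-d`
(s2, «knit N06 at the ₁₁ record»), gen 9.  A HELPER for the stage-11 certificate editions ≥ 23.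

WHAT.  Editions 19–22 display the (3.131)∕(3.137) perturbation letters through EIGHT composite majorants `hta htb hta₂ htb₂ htaR hta₂R htbR htb₂R` (n06-l g13
`B9PerturbationSplitAtLetters`: `Δ′_π = T_a∘T_b`, …, pinned to the coordinate models `TaLcoK … Tb2RcoKH`, since edition 21 at `GpPhysY`).  The four WITHOUT the residual
`Δ⁽²⁾` — `T_a = B·G′·R`-type and `T_b = P·D*`-type products (3.130) — are print's consequences of THREE per-letter estimates: Theorem 3.1 (3.42)₁₂₃ for `G′`,
(3.49)₁₂₃ for `P = I − R(U)`, and the order-zero current bound (3.117)+(3.36) for `B = Δ(U)D_U`, `B† = D*_UΔ(U)`; dag-n06-l g14 typed the algebra as HYPOTHESIS SCHEMAS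
`Thm31GpMaj ∕ Proj349Maj ∕ CurrentMaj` (`B9PerturbationMajorantAlgebra`) and proved, at the knit's coordinate models and the print-units letter,
`hta_of_letters_phys` … `htbR_of_letters_phys` (p586777): majorant kernel `const3131 (cR39 b)⁻¹ B₀ C_P c L · t_J · θ · e^{−δ_T d}` (×2 for `T_b`, `T_b′`) from the
schemas + `GeoOK` + the member `Facts347` + a row sum `RowSum … σ c`, for `δ_T + 2σ + 3αδ ≤ r ≤ min(δ₀, δ_P, δ_B)`.  THIS FILE knits them at def-Y's members in the
certificate's binder shapes: ★★ `split_majorants_of_letter_schemas` — inputs: `q : PinPrims` (member facts at `((1−2α)δ₀, α_F)` by n06-k `lemma21Pack_geo9Y`), `H`,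
the Theorem-3.12 walk letters `𝔬12` (its block maps `blkW ∕ blk`), the three schemas `h31 h49 hBJ` displayed in the (M, a)-regime under (3.35)∕(3.36) with the current
constant `t_J·(Mα₀)` (print: «each operator Δ′_π provides the small factor α₀», p. 423), the numerics `B₀ δ₀ C_P δ_P t_J δ_B r δ_T σ_S` and ONE displayed constant
`t12` dominating the DEFINITE product `2·const3131 (cR39 (trBasis N))⁻¹ B₀ C_P (rowConst261 geo9Y σ_S) (ℓ+1)·t_J` (n06-i's definite (2.61) constant
`B9RowSum261DefiniteFaces.rowConst261`, so the certificate's `hL3131H` can keep sharing `t12`); output: above ONE threshold `ML` the four majorants EXACTLY as the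
certificate displays them (`HasMaj (cNorm 1 (H x) (𝔬12 x).blk _ 2) (cNorm … 0) (TaLcoK … (GpPhysY …) U) (fun a a' => t12·(Mα₀)·e^{−δ_T d})`, …).
HONEST FRAMING.  Kernel bookkeeping (two thresholds, one `max`, four applications of n06-l's theorems per member, one kernel domination); COUNT-NEUTRAL;
nothing of [B9] asserted — the three per-letter schemas are displayed hypotheses about the genuine operators (Theorem 3.1 ∕ (3.49) ∕ (3.117) at `U ≠ 1`);
N06 NOT discharged.  One finite 𝕋⁴ programme at fixed `ε` — NOT continuum, NOT OS, NOT the mass gap ∕ Clay.  0 `def`, 0 `sorry`.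
-/

noncomputable section

namespace Summit.QuantumFields.YangMills.BalabanUVNodes.N06SplitMajorantsAtPinsPhys

open Literature.MathematicalPhysics.QuantumFieldTheory.Balaban1983to89
open Literature.MathematicalPhysics.QuantumFieldTheory.Balaban1983to89.Node00 (GpY GpPhysY parSymY)
open Literature.MathematicalPhysics.QuantumFieldTheory.Balaban1983to89.Node00.OpsYSectDCoords (DvcoKH DvscoKH)
open Literature.MathematicalPhysics.QuantumFieldTheory.Balaban1983to89.B9Thm34Ext (toB6)
open Literature.MathematicalPhysics.QuantumFieldTheory.Balaban1983to89.B11SectG (BlockNorm HasMaj RowSum)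
open Literature.MathematicalPhysics.QuantumFieldTheory.Balaban1983to89.B9Thm312Whole (GeoOK cNorm)
open Literature.MathematicalPhysics.QuantumFieldTheory.Balaban1983to89.B9Thm312WholeClasses (cNormR)
open Literature.MathematicalPhysics.QuantumFieldTheory.Balaban1983to89.B9RWSums343to347Whole (Facts347)
open Literature.MathematicalPhysics.QuantumFieldTheory.Balaban1983to89.B9RWSumsDefinitePins (PinPrims)
open Literature.MathematicalPhysics.QuantumFieldTheory.Balaban1983to89.B9RWSums347DefiniteFaces (exp261 lemma21Pack_geo9Y)
open Literature.MathematicalPhysics.QuantumFieldTheory.Balaban1983to89.B9RowSum261DefiniteFaces (rowConst261 rowConst261_nonneg rowConst261_spec_of_rowSum261)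
open Literature.MathematicalPhysics.QuantumFieldTheory.Balaban1983to89.B9PinMembersKLevelV1 (MemberY geo9Y bg9Y)
open Literature.MathematicalPhysics.QuantumFieldTheory.Balaban1983to89.B9PinGeometryKLevelV1 (c35Y)
open Literature.MathematicalPhysics.QuantumFieldTheory.Balaban1983to89.B9GeoLemma21KLevelV1 (geo9Y_len_pos geo9Y_dist_triangle geo9Y_dist_comm rowSum261_geo9Y)
open Literature.MathematicalPhysics.QuantumFieldTheory.Balaban1983to89.B9GeoNormsKLevelV1 (geo9K_dist_nonneg)
open Literature.MathematicalPhysics.QuantumFieldTheory.Balaban1983to89.B7Prop2SpecialUnitary (specialUnitaryUnits)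
open Literature.MathematicalPhysics.QuantumFieldTheory.Balaban1983to89.B9CoReadingCoords (XBK)
open Literature.MathematicalPhysics.QuantumFieldTheory.Balaban1983to89.B9CoReadingCoordsH (XHK)
open Literature.MathematicalPhysics.QuantumFieldTheory.Balaban1983to89.B9CoReadingCoordsS (XSK GcoS)
open Literature.MathematicalPhysics.QuantumFieldTheory.Balaban1983to89.B9CoReadingCoordsTranspose (TrIdx trBasis)
open Literature.MathematicalPhysics.QuantumFieldTheory.Balaban1983to89.B9Thm39ReadingCoords (cR39)
open Literature.MathematicalPhysics.QuantumFieldTheory.Balaban1983to89.Node00.OpsYSectDCoords (cR39_trBasis_pos)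
open Literature.MathematicalPhysics.QuantumFieldTheory.Balaban1983to89.B9PerturbationSplitAtLetters (TaLcoK TbLcoKH TaRcoK TbRcoKH)
open Literature.MathematicalPhysics.QuantumFieldTheory.Balaban1983to89.B9PerturbationMajorantAlgebra (Thm31GpMaj Proj349Maj CurrentMaj)
open Literature.MathematicalPhysics.QuantumFieldTheory.Balaban1983to89.B9PerturbationMajorantLetters (const3131 const3131_nonneg)
open Literature.MathematicalPhysics.QuantumFieldTheory.Balaban1983to89.B9PerturbationMajorantsAtLetters (BcoKH BdcoKH PcoK)
open Literature.MathematicalPhysics.QuantumFieldTheory.Balaban1983to89.B9PerturbationMajorantsAtLettersPhys (hta_of_letters_phys htb_of_letters_phys htaR_of_letters_phys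
  htbR_of_letters_phys)
open scoped Matrix.Norms.L2Operator

variable {N : ℕ} [NeZero N]
variable {d ℓ : ℕ} {hd : 1 ≤ d + 1} {hL : Odd (ℓ + 1) ∧ 1 < ℓ + 1} {b₀ b₁ : ℝ} {Mstar : ℕ}
variable [∀ x : MemberY d ℓ hd hL b₀ b₁ Mstar, Fintype (geo9Y x).Site]

/-- the kernel domination: `C·t_J·θ·e ≤ t·θ·e` for `C·t_J ≤ t`, `θ ≥ 0`. [cite: Balaban1985BackgroundPropagators, (3.131) p.422, bookkeeping] -/
private theorem kernel_dom {C tJ t θ e : ℝ} (hCt : C * tJ ≤ t) (hθ : 0 ≤ θ) (he : 0 ≤ e) : C * tJ * θ * e ≤ t * θ * e :=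
  mul_le_mul_of_nonneg_right (mul_le_mul_of_nonneg_right hCt hθ) he

set_option maxHeartbeats 400000 in
/-- ★★ **THE FOUR SPLIT MAJORANTS `hta htb htaR htbR` OF THE CERTIFICATE FROM THREE PER-LETTER SCHEMAS** (module docstring).  Inputs: `q : PinPrims` (for the member
facts), `H`, the Theorem-3.12 walk letters `𝔬12`; the schemas `h31` (Theorem 3.1 (3.42)₁₂₃ for `G′` at the site coordinate model `GcoS … (GpY …)` — the (3.42)
reading keeps the lattice letter, def-Y recipe (3)), `h49` ((3.49)₁₂₃ for `P = I − R` at `PcoK … (GpY …)`), `hBJ` ((3.117)+(3.36) for `B ∕ B†` at `BcoKH ∕ BdcoKH`, constant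
`t_J·(Mα₀)`), all in the regime `M ≤ M_x`, `M_x α₀ ≤ a` under (3.35)∕(3.36); numerics with `δ_T + 2σ_S + 3·α_F·((1−2α)δ₀) ≤ r ≤ min(δ₀′, δ_P, δ_B)` and
`2·const3131 (cR39 (trBasis N))⁻¹ B₀ C_P (rowConst261 geo9Y σ_S) (ℓ+1) · t_J ≤ t12`.  Output: `∃ ML`, and for every member with `ML ≤ M_x` in that regime the four
majorants of `TaLcoK ∕ TbLcoKH ∕ TaRcoK ∕ TbRcoKH … (GpPhysY x.toKIdx (parSymY x.toKIdx)) U` with kernel `t12·(M_x α₀)·e^{−δ_T d}` — the certificate's `hta htb htaR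
htbR` binder shapes VERBATIM.  Nothing of print asserted. [cite: Balaban1985BackgroundPropagators, (3.130)–(3.131) pp.421–422, (3.137) p.423, Thm 3.1 (3.42) p.397, (3.49) p.399, (3.117) p.419, (3.36) p.396; Balaban1984PropagatorsII, Lemma 2.1 (2.60)–(2.61) pp.233–234] -/
theorem split_majorants_of_letter_schemas (q : PinPrims) (hq : q.OK) (H : MemberY d ℓ hd hL b₀ b₁ Mstar → Prop)
    (𝔬12 : ∀ x : MemberY d ℓ hd hL b₀ b₁ Mstar, B9Thm312Whole.Ops (geo9Y x) (bg9Y (Matrix (Fin N) (Fin N) ℂ) (specialUnitaryUnits (Fin N)) x)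
      (XBK (TrIdx N) x.toKIdx) (XBK (TrIdx N) x.toKIdx) (XHK (TrIdx N) x.toKIdx) (XSK (TrIdx N) x.toKIdx))
    (B₀ δ₀ CP δP tJ δB r δT σS t12 M a : ℝ) (hB₀ : 0 ≤ B₀) (hCP : 0 ≤ CP) (htJ : 0 ≤ tJ) (hσS : 0 < σS) (hM : 0 < M)
    (hr₀ : r ≤ δ₀) (hrP : r ≤ δP) (hrB : r ≤ δB) (hδT : 0 ≤ δT) (hδTr : δT + 2 * σS + 3 * (q.αF * ((1 - 2 * q.α) * q.δ₀)) ≤ r)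
    (ht12 : 2 * B9PerturbationMajorantLetters.const3131 (cR39 (trBasis N))⁻¹ B₀ CP
      (rowConst261 (geo9Y (d := d) (ℓ := ℓ) (hd := hd) (hL := hL) (b₀ := b₀) (b₁ := b₁) (Mstar := Mstar)) σS) ((ℓ + 1 : ℕ) : ℝ) * tJ ≤ t12)
    (h31 : ∀ x : MemberY d ℓ hd hL b₀ b₁ Mstar, M ≤ (geo9Y x).M → ∀ α₀ : ℝ, 0 < α₀ → (geo9Y x).M * α₀ ≤ a →
      ∀ U : (bg9Y (Matrix (Fin N) (Fin N) ℂ) (specialUnitaryUnits (Fin N)) x).Cfg,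
        (bg9Y (Matrix (Fin N) (Fin N) ℂ) (specialUnitaryUnits (Fin N)) x).Reg335 c35Y α₀ U →
        (bg9Y (Matrix (Fin N) (Fin N) ℂ) (specialUnitaryUnits (Fin N)) x).Reg336 c35Y α₀ U →
          Thm31GpMaj (𝔬12 x).blkW (𝔬12 x).blk
            (GcoS x.toKIdx (trBasis N) (bg9Y (Matrix (Fin N) (Fin N) ℂ) (specialUnitaryUnits (Fin N)) x) (fun U => U) (GpY x.toKIdx (parSymY x.toKIdx)) U)
            (DvcoKH x.toKIdx (trBasis N) (bg9Y (Matrix (Fin N) (Fin N) ℂ) (specialUnitaryUnits (Fin N)) x) (fun U => U) U)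
            (DvscoKH x.toKIdx (trBasis N) (bg9Y (Matrix (Fin N) (Fin N) ℂ) (specialUnitaryUnits (Fin N)) x) (fun U => U) U) 1 (H x) B₀ δ₀)
    (h49 : ∀ x : MemberY d ℓ hd hL b₀ b₁ Mstar, M ≤ (geo9Y x).M → ∀ α₀ : ℝ, 0 < α₀ → (geo9Y x).M * α₀ ≤ a →
      ∀ U : (bg9Y (Matrix (Fin N) (Fin N) ℂ) (specialUnitaryUnits (Fin N)) x).Cfg,
        (bg9Y (Matrix (Fin N) (Fin N) ℂ) (specialUnitaryUnits (Fin N)) x).Reg335 c35Y α₀ U →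
        (bg9Y (Matrix (Fin N) (Fin N) ℂ) (specialUnitaryUnits (Fin N)) x).Reg336 c35Y α₀ U →
          Proj349Maj (𝔬12 x).blkW (𝔬12 x).blk
            (PcoK x.toKIdx (trBasis N) (bg9Y (Matrix (Fin N) (Fin N) ℂ) (specialUnitaryUnits (Fin N)) x) (fun U => U) (parSymY x.toKIdx)
              (GpY x.toKIdx (parSymY x.toKIdx)) U)
            (DvcoKH x.toKIdx (trBasis N) (bg9Y (Matrix (Fin N) (Fin N) ℂ) (specialUnitaryUnits (Fin N)) x) (fun U => U) U)
            (DvscoKH x.toKIdx (trBasis N) (bg9Y (Matrix (Fin N) (Fin N) ℂ) (specialUnitaryUnits (Fin N)) x) (fun U => U) U) 1 (H x) CP δP)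
    (hBJ : ∀ x : MemberY d ℓ hd hL b₀ b₁ Mstar, M ≤ (geo9Y x).M → ∀ α₀ : ℝ, 0 < α₀ → (geo9Y x).M * α₀ ≤ a →
      ∀ U : (bg9Y (Matrix (Fin N) (Fin N) ℂ) (specialUnitaryUnits (Fin N)) x).Cfg,
        (bg9Y (Matrix (Fin N) (Fin N) ℂ) (specialUnitaryUnits (Fin N)) x).Reg335 c35Y α₀ U →
        (bg9Y (Matrix (Fin N) (Fin N) ℂ) (specialUnitaryUnits (Fin N)) x).Reg336 c35Y α₀ U →
          CurrentMaj (𝔬12 x).blkW (𝔬12 x).blk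
            (BcoKH x.toKIdx (trBasis N) (bg9Y (Matrix (Fin N) (Fin N) ℂ) (specialUnitaryUnits (Fin N)) x) (fun U => U) U)
            (BdcoKH x.toKIdx (trBasis N) (bg9Y (Matrix (Fin N) (Fin N) ℂ) (specialUnitaryUnits (Fin N)) x) (fun U => U) U) 1 (H x)
            (tJ * ((geo9Y x).M * α₀)) δB) :
    ∃ ML : ℝ, ∀ x : MemberY d ℓ hd hL b₀ b₁ Mstar, ML ≤ (geo9Y x).M → M ≤ (geo9Y x).M → ∀ α₀ : ℝ, 0 < α₀ → (geo9Y x).M * α₀ ≤ a →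
      ∀ U : (bg9Y (Matrix (Fin N) (Fin N) ℂ) (specialUnitaryUnits (Fin N)) x).Cfg,
        (bg9Y (Matrix (Fin N) (Fin N) ℂ) (specialUnitaryUnits (Fin N)) x).Reg335 c35Y α₀ U →
        (bg9Y (Matrix (Fin N) (Fin N) ℂ) (specialUnitaryUnits (Fin N)) x).Reg336 c35Y α₀ U →
          HasMaj (cNorm 1 (H x) (𝔬12 x).blk (fun y => (geo9Y_len_pos x y).le) 2) (cNorm 1 (H x) (𝔬12 x).blk (fun y => (geo9Y_len_pos x y).le) 0)
              (TaLcoK x.toKIdx (trBasis N) (bg9Y (Matrix (Fin N) (Fin N) ℂ) (specialUnitaryUnits (Fin N)) x) (fun U => U) (parSymY x.toKIdx)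
                (GpPhysY x.toKIdx (parSymY x.toKIdx)) U)
              (fun a a' => t12 * ((geo9Y x).M * α₀) * Real.exp (-(δT * (geo9Y x).dist a a'))) ∧
            HasMaj (cNorm 1 (H x) (𝔬12 x).blk (fun y => (geo9Y_len_pos x y).le) 2) (cNorm 1 (H x) (𝔬12 x).blkW (fun y => (geo9Y_len_pos x y).le) 1)
              (TbLcoKH x.toKIdx (trBasis N) (bg9Y (Matrix (Fin N) (Fin N) ℂ) (specialUnitaryUnits (Fin N)) x) (fun U => U) (parSymY x.toKIdx)
                (GpPhysY x.toKIdx (parSymY x.toKIdx)) U)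
              (fun a a' => t12 * ((geo9Y x).M * α₀) * Real.exp (-(δT * (geo9Y x).dist a a'))) ∧
            HasMaj (cNorm 1 (H x) (𝔬12 x).blk (fun y => (geo9Y_len_pos x y).le) 2) (cNorm 1 (H x) (𝔬12 x).blk (fun y => (geo9Y_len_pos x y).le) 0)
              (TaRcoK x.toKIdx (trBasis N) (bg9Y (Matrix (Fin N) (Fin N) ℂ) (specialUnitaryUnits (Fin N)) x) (fun U => U) (parSymY x.toKIdx)
                (GpPhysY x.toKIdx (parSymY x.toKIdx)) U)
              (fun a a' => t12 * ((geo9Y x).M * α₀) * Real.exp (-(δT * (geo9Y x).dist a a'))) ∧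
            HasMaj (cNormR 1 (H x) (𝔬12 x).blkW (fun y => (geo9Y_len_pos x y).le) 0) (cNormR 1 (H x) (𝔬12 x).blk (fun y => (geo9Y_len_pos x y).le) 1)
              (TbRcoKH x.toKIdx (trBasis N) (bg9Y (Matrix (Fin N) (Fin N) ℂ) (specialUnitaryUnits (Fin N)) x) (fun U => U) (parSymY x.toKIdx)
                (GpPhysY x.toKIdx (parSymY x.toKIdx)) U)
              (fun a a' => t12 * ((geo9Y x).M * α₀) * Real.exp (-(δT * (geo9Y x).dist a a'))) := by
  -- member facts at ((1 − 2α)δ₀, α_F) (n06-k) and [4] (2.61) at the rate σ_S with n06-i's DEFINITE constant, above ONE threshold each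
  obtain ⟨ML, -, hfacts, -⟩ :=
    lemma21Pack_geo9Y (d := d) (ℓ := ℓ) (hd := hd) (hL := hL) (b₀ := b₀) (b₁ := b₁) (Mstar := Mstar) H hq.α_pos hq.α_lt
      hq.δ₀_pos hq.αF_pos (by linarith only [hq.αF_lt])
  obtain ⟨MLσ, hrowc⟩ := rowConst261_spec_of_rowSum261
    (rowSum261_geo9Y (d := d) (ℓ := ℓ) (hd := hd) (hL := hL) (b₀ := b₀) (b₁ := b₁) (Mstar := Mstar)) hσS
  have hN : 0 < N := Nat.pos_of_ne_zero (NeZero.ne N)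
  have hc0 : 0 < cR39 (trBasis N) := cR39_trBasis_pos hN
  have hcσ : 0 ≤ rowConst261 (geo9Y (d := d) (ℓ := ℓ) (hd := hd) (hL := hL) (b₀ := b₀) (b₁ := b₁) (Mstar := Mstar)) σS :=
    rowConst261_nonneg _ _
  have hτ : 0 ≤ q.αF * ((1 - 2 * q.α) * q.δ₀) :=
    mul_nonneg hq.αF_pos.le (mul_nonneg (by linarith only [hq.α_lt]) hq.δ₀_pos.le)
  have hL1 : (1 : ℝ) ≤ ((ℓ + 1 : ℕ) : ℝ) := by exact_mod_cast Nat.succ_le_succ (Nat.zero_le _)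
  -- the constant: const3131·t_J ≤ 2·const3131·t_J ≤ t12
  have hC0 : 0 ≤ B9PerturbationMajorantLetters.const3131 (cR39 (trBasis N))⁻¹ B₀ CP
      (rowConst261 (geo9Y (d := d) (ℓ := ℓ) (hd := hd) (hL := hL) (b₀ := b₀) (b₁ := b₁) (Mstar := Mstar)) σS) ((ℓ + 1 : ℕ) : ℝ) :=
    const3131_nonneg (inv_nonneg.2 hc0.le) hB₀ hCP hcσ hL1
  have ht1 : B9PerturbationMajorantLetters.const3131 (cR39 (trBasis N))⁻¹ B₀ CP
      (rowConst261 (geo9Y (d := d) (ℓ := ℓ) (hd := hd) (hL := hL) (b₀ := b₀) (b₁ := b₁) (Mstar := Mstar)) σS) ((ℓ + 1 : ℕ) : ℝ) * tJ ≤ t12 := by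
    have := mul_nonneg hC0 htJ
    linarith
  refine ⟨max ML MLσ, fun x hMx hMM α₀ hα ha U hU hU' => ?_⟩
  have hgeo : GeoOK (geo9Y x) := ⟨geo9Y_dist_triangle x, geo9Y_dist_comm x, geo9K_dist_nonneg x.toKIdx, geo9Y_len_pos x⟩
  have hF := hfacts x ((le_max_left _ _).trans hMx)
  have hrow : RowSum (toB6 (geo9Y x) 1 (H x)) σS
      (rowConst261 (geo9Y (d := d) (ℓ := ℓ) (hd := hd) (hL := hL) (b₀ := b₀) (b₁ := b₁) (Mstar := Mstar)) σS) :=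
    fun y => hrowc x ((le_max_right _ _).trans hMx) y
  have hθ : 0 ≤ (geo9Y x).M * α₀ := mul_nonneg (hM.le.trans hMM) hα.le
  have hA := hta_of_letters_phys hgeo hF hrow hc0 (h31 x hMM α₀ hα ha U hU hU') (h49 x hMM α₀ hα ha U hU hU') (hBJ x hMM α₀ hα ha U hU hU')
    hB₀ hCP htJ hθ hcσ hσS.le hτ hr₀ hrP hrB hδT hδTr
  have hB := htb_of_letters_phys hgeo hF hrow hc0 (h31 x hMM α₀ hα ha U hU hU') (h49 x hMM α₀ hα ha U hU hU') (hBJ x hMM α₀ hα ha U hU hU')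
    hB₀ hCP htJ hθ hcσ hσS.le hτ hr₀ hrP hrB hδT hδTr
  have hAR := htaR_of_letters_phys hgeo hF hrow hc0 (h31 x hMM α₀ hα ha U hU hU') (h49 x hMM α₀ hα ha U hU hU') (hBJ x hMM α₀ hα ha U hU hU')
    hB₀ hCP htJ hθ hcσ hσS.le hτ hr₀ hrP hrB hδT hδTr
  have hBR := htbR_of_letters_phys hgeo hF hrow hc0 (h31 x hMM α₀ hα ha U hU hU') (h49 x hMM α₀ hα ha U hU hU') (hBJ x hMM α₀ hα ha U hU hU')
    hB₀ hCP htJ hθ hcσ hσS.le hτ hr₀ hrP hrB hδT hδTr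
  have he : ∀ a a' : (geo9Y x).Site, 0 ≤ Real.exp (-(δT * (geo9Y x).dist a a')) := fun _ _ => Real.exp_nonneg _
  exact ⟨hA.mono fun a a' => kernel_dom ht1 hθ (he a a'), hB.mono fun a a' => kernel_dom ht12 hθ (he a a'),
    hAR.mono fun a a' => kernel_dom ht1 hθ (he a a'), hBR.mono fun a a' => kernel_dom ht12 hθ (he a a')⟩

end Summit.QuantumFields.YangMills.BalabanUVNodes.N06SplitMajorantsAtPinsPhys

end
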